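import Mathlib
import Literature.Analysis.FluidPDE.Tao2016AveragedNS.RenormalisedCascadeWaves
import Literature.Analysis.FluidPDE.Tao2016AveragedNS.CascadeTableDictionary
import Literature.Analysis.FluidPDE.Tao2016AveragedNS.SelfSimilarCascadeBlowup
import Literature.Analysis.FluidPDE.Tao2016AveragedNS.ViscousEternalSolutions
import Literature.Analysis.FluidPDE.Tao2016AveragedNS.BoundedEternalSolutions
import Summits.NavierStokesRegularity.NavierStokesRegularity.Theorems.TaoLadderRungTwoBreakNoSurvivingEternalViscBddOneRankOneReduction
import Summits.NavierStokesRegularity.NavierStokesRegularity.Theorems.WakeRatchetAdmissibleEternalBoundDyadic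
import HarnessLib

/-!
# Route TaoLadderRungTwoBreak — the RANK-ONE (polarised) SECTOR of the K1-type statements IS the dyadic
# member: the dyadic shadow of an active polarisation (route-independent core; no `Theses` import)
# (`--supports` stmt-NavierStokesRegularity-20419; part 2 of 3, siblings `…RankOneReduction`, `…RankOneByName`)

MODEL lattice (Tao 2016 §4) only; nothing here is a statement about the Navier–Stokes equations; no stub,
crux, rung or summit is proved by this file.

Part 1 (`…RankOneReduction`) showed: the amplitudes `c_n` of a rank-one admissible eternal solution
`W_n = c_n·v` of ANY cancelling table solve the scalar chain with coupling `κ(v) = ⟪v, A v⟫/‖v‖²`, and a NULL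
polarisation (`κ = 0`) forces `W ≡ 0`.  Here the ACTIVE case: for `κ(v) ≠ 0` the DYADIC SHADOW
`U_n = κ(v)c_n·e₀` is an admissible eternal solution of `dyadicTable` with the same `ε₀` and covariant
viscosity `ν̂` (`isEternalVisc_rankOne_shadow`), with `‖U_n(σ)‖ = (|κ|/‖v‖)·‖W_n(σ)‖` (`norm_shadow`), so
uniform bounds and forward (S_a)-survival transfer (`uniformBound_of_norm_eq_mul`,
`eternalSurvivingFwd_of_norm_eq_mul`).  Hence the DICHOTOMY gives (`ε₀ > 0` fixed):

* `rankOne_not_surviving_of_dyadic`: the viscous dyadic slice at `(ε₀, ν̂, a)` ⟹ no uniformly bounded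
  rank-one admissible eternal solution (covariant viscosity `ν̂`) of ANY cancelling `Fin 4`-table — any
  spread, symmetric or not — is (S_a)-surviving forward;
* `rankOne_not_surviving_of_dyadic_inviscid`: the inviscid dyadic slice ⟹ the same for rank-one INVISCID
  solutions with NO uniform bound assumed (the shadow is bounded by the tree's `uniformBound_dyadic`);
* `dyadic_iff_rankOne`: at fixed `(ε₀, a)`, «inviscid dyadic Liouville ⟺ rank-one Liouville over all
  cancelling tables» (dyadic solutions are rank-one along `e₀`, `dyadic_rankOne`);
* BY NAME (sibling glue file `…RankOneByName`, through the twin-rotor embedding dyadic ↪ rank-one sector of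
  the spread-ONE table): for every `R ≥ 1`, `NoSurvivingEternalViscBdd R a` / `NoSurvivingEternalBdd R a` and
  the route decls ⟹ the rank-one statements for all cancelling tables.

READING for the census of ⟨20419⟩/⟨20205⟩: the polarised sector of «∀ R ≥ 1, ∀ α ∈ E₂(R)» carries no
table-dependence and no spread-dependence at all — it is exactly the dyadic wake law W1-dyadic; the table and
its spread enter the cruxes only through genuinely multi-directional solutions.  HONEST LABEL: reduction of
a thin sector; every stub of ⟨20419⟩, ⟨20420⟩, ⟨20205⟩ remains OPEN.
-/

noncomputable section

-- the sub-problem namespace repeats the summit name by design (D-0017)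
set_option linter.dupNamespace false

namespace Summit.NavierStokesRegularity.NavierStokesRegularity.Theorems.TaoLadderRungTwoBreakRankOne

open Filter Topology MeasureTheory Set
open scoped RealInnerProductSpace
open Literature.Analysis.FluidPDE Literature.Analysis.FluidPDE.TaoCascade
open Summit.NavierStokesRegularity.NavierStokesRegularity.Theorems.WakeRatchetDyadic
  (dyadic_apply_ne_zero)


/-! ## Active polarisations: the dyadic shadow -/

section Shadow

variable {ε₀ νh : ℝ} {α : Fin 4 → Fin 4 → Fin 4 → ℤ × ℤ × ℤ → ℝ}
  {W : ℤ → ℝ → Em 4} {v : Em 4} {c : ℤ → ℝ → ℝ} {κ : ℝ}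

/-- The shadow scales every shell norm by `|κ|/‖v‖`: `‖κc_n•e₀‖ = (|κ|/‖v‖)·‖c_n•v‖`. [elementary] -/
theorem norm_shadow (hv : v ≠ 0) (hWv : ∀ n σ, W n σ = c n σ • v) (κ : ℝ) (n : ℤ) (σ : ℝ) :
    ‖(κ * c n σ) • EuclideanSpace.single (0 : Fin 4) (1 : ℝ)‖ = |κ| / ‖v‖ * ‖W n σ‖ := by
  have hvpos : 0 < ‖v‖ := norm_pos_iff.2 hv
  rw [norm_smul_axis, norm_rankOne hWv, abs_mul]
  field_simp

/-- **THE DYADIC SHADOW.**  For a rank-one admissible eternal solution `W_n = c_n•v` of a cancelling table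
(`ε₀ > 0`, covariant viscosity `ν̂ ≥ 0`) and `κ = ⟪v, A v⟫/‖v‖²`, the family `U_n = κc_n•e₀` is an admissible
eternal solution of the DYADIC member with the same `ε₀` and `ν̂`.
[cite: Tao2016AveragedNS, §1.2 (dyadic model), §4 (4.3), Lemma 4.1 (4.8), the viscous equation before Thm. 4.2, §6.4; cell vocabulary (`IsEternalVisc`, `dyadicTable`)] -/
theorem isEternalVisc_rankOne_shadow (hc : IsCancellingCoeff α) (hv : v ≠ 0)
    (hWv : ∀ n σ, W n σ = c n σ • v) (hW : IsEternalVisc ε₀ νh α W)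
    (hκ : κ = ⟪v, tableA α v⟫ / ‖v‖ ^ 2) :
    IsEternalVisc ε₀ νh dyadicTable
      (fun n σ => (κ * c n σ) • EuclideanSpace.single (0 : Fin 4) (1 : ℝ)) := by
  have hvpos : 0 < ‖v‖ := norm_pos_iff.2 hv
  refine isEternalVisc_dyadic_of_scalar (u := fun n σ => κ * c n σ) hW.nonneg ?_ ?_ ?_
  · intro n σ
    have h := (hasDerivAt_rankOne_coeff hc hv hWv hW n σ).const_mul κ
    rw [← hκ] at h
    refine h.congr_deriv ?_
    ring
  · obtain ⟨M, hM⟩ := hW.action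
    refine ⟨|κ| / ‖v‖ * M, fun n => ?_⟩
    have hfun : (fun σ => |κ * c n σ|) = fun σ => |κ| / ‖v‖ * ‖W n σ‖ := by
      funext σ
      rw [← norm_smul_axis 0, norm_shadow hv hWv]
    rw [hfun, integral_const_mul]
    exact ⟨(hM n).1.const_mul _, mul_le_mul_of_nonneg_left (hM n).2 (by positivity)⟩
  · intro n
    obtain ⟨σ₀, P, hP⟩ := hW.bdd n
    refine ⟨σ₀, (|κ| / ‖v‖) ^ 2 * P, fun σ hσ => ?_⟩
    have e : (κ * c n σ) ^ 2 = (|κ| / ‖v‖) ^ 2 * ‖W n σ‖ ^ 2 := by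
      rw [← sq_abs, ← norm_smul_axis 0, norm_shadow hv hWv, mul_pow]
    rw [e]
    have := hP σ hσ
    have h0 : 0 ≤ (|κ| / ‖v‖) ^ 2 := sq_nonneg _
    nlinarith

/-- Forward (S_a)-survival transfers along a fixed positive rescaling of all shell norms.
[cite: Tao2016AveragedNS, §4 (the viscous equation before Thm. 4.2), §6.4; cell vocabulary (`EternalSurvivingFwd`)] -/
theorem eternalSurvivingFwd_of_norm_eq_mul {a r : ℝ} {U W : ℤ → ℝ → Em 4} (hε : 0 < ε₀) (hr : 0 < r)
    (h : ∀ (n : ℤ) (σ : ℝ), ‖U n σ‖ = r * ‖W n σ‖) (hS : EternalSurvivingFwd a ε₀ W) :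
    EternalSurvivingFwd a ε₀ U := by
  obtain ⟨c, hc, H⟩ := hS
  refine ⟨r ^ 2 * c, by positivity, fun N => ?_⟩
  obtain ⟨n, hn, σ, hσ, hle⟩ := H N
  refine ⟨n, hn, σ, hσ, ?_⟩
  rw [h n σ, mul_pow]
  have hpw : 0 ≤ physWeight a ε₀ ^ n := pow_nonneg (physWeight_nonneg hε.le) n
  have e : physWeight a ε₀ ^ n * (Real.exp (2 * σ) * (r ^ 2 * ‖W n σ‖ ^ 2))
      = r ^ 2 * (physWeight a ε₀ ^ n * (Real.exp (2 * σ) * ‖W n σ‖ ^ 2)) := by ring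
  rw [e]
  exact mul_le_mul_of_nonneg_left hle (sq_nonneg r)

/-- Uniform bounds transfer along a fixed rescaling of all shell norms.
[cite: Tao2016AveragedNS, §4 Thm. 4.2 (statement shape), §6.4; cell vocabulary (`UniformBound`)] -/
theorem uniformBound_of_norm_eq_mul {r : ℝ} {U W : ℤ → ℝ → Em 4} (hr : 0 ≤ r)
    (h : ∀ (n : ℤ) (σ : ℝ), ‖U n σ‖ = r * ‖W n σ‖) (hU : UniformBound W) : UniformBound U := by
  obtain ⟨C, hC⟩ := hU
  refine ⟨r * C, fun k σ => ?_⟩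
  rw [h k σ]
  exact mul_le_mul_of_nonneg_left (hC k σ) hr

/-- **DICHOTOMY ⟹ the viscous dyadic slice governs ALL rank-one solutions.**  Fix `ε₀ > 0`, `ν̂`, `a`.  If no
uniformly bounded admissible eternal solution of `dyadicTable` with covariant viscosity `ν̂` is (S_a)-surviving
forward, then no uniformly bounded RANK-ONE admissible eternal solution (covariant viscosity `ν̂`) of ANY
cancelling `Fin 4`-table is — whatever its spread, symmetric or not.
[cite: Tao2016AveragedNS, §1.2, §4 (4.3), Thm. 4.2 (statement shape), §6.4; cell vocabulary (`IsEternalVisc`, `UniformBound`, `EternalSurvivingFwd`)] -/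
theorem rankOne_not_surviving_of_dyadic {a : ℝ} (hε : 0 < ε₀)
    (hdy : ∀ U : ℤ → ℝ → Em 4, IsEternalVisc ε₀ νh dyadicTable U → UniformBound U →
      ¬ EternalSurvivingFwd a ε₀ U)
    (hc : IsCancellingCoeff α) (hv : v ≠ 0) (hWv : ∀ n σ, W n σ = c n σ • v)
    (hW : IsEternalVisc ε₀ νh α W) (hU : UniformBound W) : ¬ EternalSurvivingFwd a ε₀ W := by
  by_cases hA : ⟪v, tableA α v⟫ = 0
  · exact rankOne_null_not_surviving hε hc hv hA hWv hW
  · intro hS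
    have hvpos : 0 < ‖v‖ := norm_pos_iff.2 hv
    set κ : ℝ := ⟪v, tableA α v⟫ / ‖v‖ ^ 2 with hκ
    have hκ0 : κ ≠ 0 := div_ne_zero hA (pow_ne_zero 2 hvpos.ne')
    have hr : 0 < |κ| / ‖v‖ := div_pos (abs_pos.2 hκ0) hvpos
    have hshadow := isEternalVisc_rankOne_shadow hc hv hWv hW hκ
    have hnorm := norm_shadow hv hWv κ
    exact hdy _ hshadow (uniformBound_of_norm_eq_mul hr.le hnorm hU)
      (eternalSurvivingFwd_of_norm_eq_mul hε hr hnorm hS)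

/-- **The inviscid dyadic slice governs all rank-one INVISCID solutions — with NO uniform bound assumed**
(the shadow is an admissible inviscid dyadic solution, bounded by `uniformBound_dyadic`).
[cite: Tao2016AveragedNS, §1.2, §4 (4.3), Thm. 4.2 (statement shape), §6.4; cell vocabulary (`IsEternal`, `EternalSurvivingFwd`); tree `uniformBound_dyadic`] -/
theorem rankOne_not_surviving_of_dyadic_inviscid {a : ℝ} (hε : 0 < ε₀)
    (hdy : ∀ U : ℤ → ℝ → Em 4, IsEternal ε₀ dyadicTable U → ¬ EternalSurvivingFwd a ε₀ U)
    (hc : IsCancellingCoeff α) (hv : v ≠ 0) (hWv : ∀ n σ, W n σ = c n σ • v)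
    (hW : IsEternal ε₀ α W) : ¬ EternalSurvivingFwd a ε₀ W := by
  by_cases hA : ⟪v, tableA α v⟫ = 0
  · exact rankOne_null_not_surviving hε hc hv hA hWv hW.isEternalVisc
  · intro hS
    have hvpos : 0 < ‖v‖ := norm_pos_iff.2 hv
    set κ : ℝ := ⟪v, tableA α v⟫ / ‖v‖ ^ 2 with hκ
    have hκ0 : κ ≠ 0 := div_ne_zero hA (pow_ne_zero 2 hvpos.ne')
    have hr : 0 < |κ| / ‖v‖ := div_pos (abs_pos.2 hκ0) hvpos
    have hshadow := isEternalVisc_rankOne_shadow hc hv hWv hW.isEternalVisc hκ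
    have hnorm := norm_shadow hv hWv κ
    exact hdy _ (isEternalVisc_zero_iff.1 hshadow) (eternalSurvivingFwd_of_norm_eq_mul hε hr hnorm hS)

/-- An admissible eternal solution of the dyadic member IS rank-one along `e₀` (its other components vanish,
tree `dyadic_apply_ne_zero`). [cite: Tao2016AveragedNS, §1.2, §6.4; tree `WakeRatchetDyadic.dyadic_apply_ne_zero`] -/
theorem dyadic_rankOne (hε : 0 < ε₀) {U : ℤ → ℝ → Em 4} (hU : IsEternalVisc ε₀ νh dyadicTable U)
    (n : ℤ) (σ : ℝ) : U n σ = (U n σ 0) • EuclideanSpace.single (0 : Fin 4) (1 : ℝ) := by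
  ext j
  by_cases hj : j = 0
  · subst hj; simp
  · simp [hj, dyadic_apply_ne_zero hε hU n hj σ]

/-- **EQUIVALENCE at fixed `(ε₀, a)`: the inviscid dyadic Liouville statement ⟺ the rank-one Liouville
statement over ALL cancelling `Fin 4`-tables** (no uniform bound on either side).
[cite: Tao2016AveragedNS, §1.2, §4 (4.3), Thm. 4.2 (statement shape), §6.4; cell vocabulary] -/
theorem dyadic_iff_rankOne (hε : 0 < ε₀) (a : ℝ) :
    (∀ U : ℤ → ℝ → Em 4, IsEternal ε₀ dyadicTable U → ¬ EternalSurvivingFwd a ε₀ U) ↔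
    (∀ α : Fin 4 → Fin 4 → Fin 4 → ℤ × ℤ × ℤ → ℝ, IsCancellingCoeff α →
      ∀ (W : ℤ → ℝ → Em 4) (v : Em 4) (c : ℤ → ℝ → ℝ), v ≠ 0 → (∀ n σ, W n σ = c n σ • v) →
        IsEternal ε₀ α W → ¬ EternalSurvivingFwd a ε₀ W) := by
  constructor
  · intro hdy α hc W v c hv hWv hW
    exact rankOne_not_surviving_of_dyadic_inviscid hε hdy hc hv hWv hW
  · intro h U hU
    have hv : EuclideanSpace.single (0 : Fin 4) (1 : ℝ) ≠ 0 := by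
      intro h0
      have := congrArg (fun x : Em 4 => x 0) h0
      simp at this
    exact h dyadicTable dyadicTable_cancelling U (EuclideanSpace.single (0 : Fin 4) (1 : ℝ))
      (fun n σ => U n σ 0) hv (fun n σ => dyadic_rankOne hε hU.isEternalVisc n σ) hU

end Shadow

end Summit.NavierStokesRegularity.NavierStokesRegularity.Theorems.TaoLadderRungTwoBreakRankOne

end
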